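import Summits.ABC.ABC.Theses.DefiniteXi

/-!
# Ideator-3 sketch for crux XiBound (stmt-ABC-11336) — first lemmas of the two idea cards

Card `max-quarantine-reduction`: XiBound for ALL admissible N⁻ follows from the single
"maximally quarantined" bound `XiMaxBound` (N⁻ = the odd part of N up to at most one prime),
a ratio control between two admissible quarantines (Pollack–Weston Thm 6.8 shape) and a
polynomial bound for the product of odd discriminant exponents (Pasten's theorem, tree fact
`pasten2024_thm_2_5` shape).

Card `tropical-winding-vector`: in the dominant-prime regime, the bet `WindingHalfBound`
(every supersingular annulus winds < q/2 times: ξ ≤ (q/2)²·Σ_c w_c for every setup) plus the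
Eichler mass bound gives XiBound there with A = 3.
-/

namespace Summit.ABC.ABC.Cruxes.XiBound.Ideator3

open Literature.NumberTheory.EllipticCurves Literature.NumberTheory.Automorphic

/-- The Brandt eigenvalue system of the Frey curve. -/
noncomputable def lam (a b : ℤ) : ℕ → ℤ := fun n => (freyCurve a b).LFunction n

/-- Admissible quarantine level: odd, squarefree, odd number of prime factors, dividing N. -/
def Admissible (N M : ℕ) : Prop := Odd M ∧ Squarefree M ∧ Odd M.primeFactors.card ∧ M ∣ N

/-- `M` is a MAXIMAL admissible quarantine of `N`: every odd prime of `N` outside `M` is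
unique (at most one odd prime of `N` is left on the split side). -/
def MaxAdmissible (N M : ℕ) : Prop :=
  Admissible N M ∧ ∀ q q' : ℕ, q.Prime → q'.Prime → q ∣ N → q' ∣ N → q ≠ 2 → q' ≠ 2 →
    ¬ q ∣ M → ¬ q' ∣ M → q = q'

/-- Card 1, item (K1): the maximally quarantined congruence number is polynomial. -/
def XiMaxBound : Prop :=
  ∃ A C : ℝ, ∀ a b : ℤ, IsCoprime a b → a * b * (a + b) ≠ 0 → ∀ (N : ℕ) [NeZero N],
    (freyCurve a b).conductorNorm ℤ = N → ∀ M : ℕ, MaxAdmissible N M →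
      (brandtXi (N / M) M (lam a b) : ℝ) ≤ C * (N : ℝ) ^ A

/-- Card 1, item (K2): ratio control between nested admissible quarantines `Nm ∣ M`
(Pollack–Weston Thm 6.8 / Ribet–Takahashi shape with the Eisenstein unit bounded by `N^B`). -/
def RatioControl : Prop :=
  ∃ B C : ℝ, ∀ a b : ℤ, IsCoprime a b → a * b * (a + b) ≠ 0 → ∀ (N : ℕ) [NeZero N],
    (freyCurve a b).conductorNorm ℤ = N → ∀ Nm M : ℕ, Admissible N Nm → Admissible N M → Nm ∣ M →
      (brandtXi (N / Nm) Nm (lam a b) : ℝ) ≤ C * (N : ℝ) ^ B * (brandtXi (N / M) M (lam a b) : ℝ) *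
        ∏ q ∈ (M / Nm).primeFactors,
          ((((freyCurve a b).minimalDiscriminantNorm ℤ).factorization q : ℕ) : ℝ)

/-- Card 1, item (P1, known: Pasten 2024 Thm 16.8 gives exponent 8/3 + ε): the product of the
odd discriminant exponents of a Frey curve is polynomial in the conductor. -/
def ExponentProductBound : Prop :=
  ∃ B C : ℝ, ∀ a b : ℤ, IsCoprime a b → a * b * (a + b) ≠ 0 → ∀ (N : ℕ) [NeZero N],
    (freyCurve a b).conductorNorm ℤ = N → ∀ M : ℕ, Squarefree M → M ∣ N →
      (∏ q ∈ M.primeFactors,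
          ((((freyCurve a b).minimalDiscriminantNorm ℤ).factorization q : ℕ) : ℝ)) ≤ C * (N : ℝ) ^ B

/-- **First lemma of card `max-quarantine-reduction`** (signature only; the proof is bookkeeping:
for admissible `Nm` pick a maximal admissible `M ⊇ Nm`, chain K2, K1, P1 and absorb constants). -/
theorem xiBound_of_xiMaxBound :
    XiMaxBound → RatioControl → ExponentProductBound →
      Summit.ABC.ABC.Theses.DefiniteXi.XiBound := by
  sorry

/-- Card 2, the bet (W): in every Brandt setup of level `(N/q, q)` the congruence number is at
most `(q/2)² · Σ_c w_c` — the typed shadow of "every supersingular annulus of `X₀(N)` at `q`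
winds fewer than `q/2` times around the Tate curve" (then `ξ t² = Σ_c w_c m_c² ≤ (q/2)² Σ_c w_c`). -/
def WindingHalfBound (δ : ℝ) : Prop :=
  ∀ a b : ℤ, IsCoprime a b → a * b * (a + b) ≠ 0 → ∀ (N : ℕ) [NeZero N],
    (freyCurve a b).conductorNorm ℤ = N → ∀ q : ℕ, q.Prime → q ≠ 2 → q ∣ N →
      (N : ℝ) ^ (1 - δ) ≤ (q : ℝ) →
      ∀ S : Brandt.XiSetup (N / q) q, ∀ _hS : Fintype (Brandt.ClassSet S.O),
        (S.xi (lam a b) : ℝ) ≤ ((q : ℝ) / 2) ^ 2 * ∑ c : Brandt.ClassSet S.O, (Brandt.weight S.O c : ℝ)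

/-- Card 2, known input (Eichler's mass formula shape): total weight of the class set of an
Eichler order of level `(N⁺, N⁻)` is at most `C · N⁺ N⁻`. -/
def MassBound : Prop :=
  ∃ C : ℝ, ∀ Np Nm : ℕ, ∀ S : Brandt.XiSetup Np Nm, ∀ _hS : Fintype (Brandt.ClassSet S.O),
    (∑ c : Brandt.ClassSet S.O, (Brandt.weight S.O c : ℝ)) ≤ C * (Np : ℝ) * (Nm : ℝ)

/-- XiBound restricted to the dominant-prime regime `q ≥ N^{1-δ}` (prime quarantine). -/
def XiBoundDominant (δ : ℝ) : Prop :=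
  ∃ A C : ℝ, ∀ a b : ℤ, IsCoprime a b → a * b * (a + b) ≠ 0 → ∀ (N : ℕ) [NeZero N],
    (freyCurve a b).conductorNorm ℤ = N → ∀ q : ℕ, q.Prime → q ≠ 2 → q ∣ N →
      (N : ℝ) ^ (1 - δ) ≤ (q : ℝ) →
      (brandtXi (N / q) q (lam a b) : ℝ) ≤ C * (N : ℝ) ^ A

/-- **First lemma of card `tropical-winding-vector`** (signature only; proof: `brandtXi_le_of_forall`,
W and the mass bound give `ξ ≤ (q²/4)·C·N ≤ C N³`). -/
theorem xiBoundDominant_of_windingHalfBound (δ : ℝ) :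
    WindingHalfBound δ → MassBound → XiBoundDominant δ := by
  sorry

end Summit.ABC.ABC.Cruxes.XiBound.Ideator3
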